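import Summits.CriticalPhenomena.Ising3DConformalLimit.Theorems.CanonicalBranchRefutationInfraredExponentZeroSharpHalfBet
import Summits.CriticalPhenomena.Ising3DConformalLimit.Theorems.AnomalousForcesInteractionEtaPositiveOfOneArm
import Summits.CriticalPhenomena.Ising3DConformalLimit.Theorems.PerfectScreeningScreeningDichotomy
import HarnessLib

/-!
# Crux `EtaPositive` (stmt-CriticalPhenomena-2600): the window of the one-arm certificate

Route `AnomalousForcesInteraction` (Ising3DConformalLimit), line `registered`. The second pre-paid closing of
the crux, `EtaPositive_of_oneArmGain` (p152034): a one-arm bound `⟨σ₀⟩⁺_{B(L);β_c(3),0} ≤ C L^{-a}`, `L ≥ L₀`,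
with SOME `a > 1/2` gives `EtaPositive` with `κ = 2a - 1`. This file calibrates that certificate by two
UNCONDITIONAL theorems about the nearest-neighbour Ising model on `ℤ³`:

* `oneArm_frequently_ge_rpow` — **a subsequence floor for the critical one-arm quantity**: there is `c > 0`
  with `c L^{-3/4} ≤ ⟨σ₀⟩⁺_{B(L);β_c(3),0}` for infinitely many `L`. Proof: the sharp axis floor
  `c₀ n^{-3/2} ≤ ⟨σ₀σ_{ne₁}⟩_{β_c(3)}` for infinitely many `n` (Duminil-Copin–Panis 2025 Thm 1.3 at exponent
  `3/2`, tree theorem `exists_frequently_mul_rpow_le_criticalTwoPoint_axis`) and the GKS decoupling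
  `⟨σ₀σ_x⟩⁺ ≤ (⟨σ₀⟩⁺_{B(L)})²` for `‖x‖_∞ ≥ 2L+2` (`twoPointPlus_le_isingCorr_plus_box_sq`, p152034), with
  `L = ⌊(n-2)/2⌋`, `n ≤ 5L`. (In print, van Engelenburg–Garban–Panis–Severo, arXiv:2510.23423 Thm 1.1, give
  `⟨σ₀⟩⁺_{Λ_n;β_c} ≥ c/n` for all `n`; along a subsequence the exponent here is `3/4`.)
* `oneArm_exponent_le_threeQuarters` — hence any one-arm upper bound `⟨σ₀⟩⁺_{B(L);β_c(3),0} ≤ C L^{-a}`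
  (`L ≥ L₀`) has `a ≤ 3/4`: the admissible window of the one-arm certificate is `a ∈ (1/2, 3/4]`
  (conjecturally `a = Δ_σ ≈ 0.518`).

No named fact is assumed; standard axioms.
-/

noncomputable section

namespace Summit.CriticalPhenomena.Ising3DConformalLimit.AnomalousForcesInteractionEtaPositive

open Filter Topology Finset Literature.Probability.LatticeModels

/-- **Subsequence floor for the critical one-arm quantity on `ℤ³`.** There is `c > 0` such that the
plus-boundary magnetisation at the centre of the box `B(L)` at `β_c(3)`, `h = 0`, satisfies
`c L^{-3/4} ≤ ⟨σ₀⟩⁺_{B(L);β_c(3),0}` for infinitely many `L`: for `n` in the subsequence of the axis floor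
`c₀ n^{-3/2} ≤ ⟨σ₀σ_{ne₁}⟩_{β_c}` (`exists_frequently_mul_rpow_le_criticalTwoPoint_axis`) and `L = ⌊(n-2)/2⌋`
(so `2L+2 ≤ n ≤ 5L`), `c₀ n^{-3/2} ≤ ⟨σ₀σ_{ne₁}⟩ ≤ (⟨σ₀⟩⁺_{B(L)})²` (`twoPointPlus_le_isingCorr_plus_box_sq`) and
`(√c₀/5 · L^{-3/4})² = (c₀/25) L^{-3/2} ≤ c₀ (5L)^{-3/2} ≤ c₀ n^{-3/2}`. Registered stub of stmt-CriticalPhenomena-2600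
(verbatim one-line header). [cite: DuminilCopinPanis2025LowerBounds, Theorem 1.3] -/
theorem oneArm_frequently_ge_rpow : ∃ c : ℝ, 0 < c ∧ ∃ᶠ L : ℕ in Filter.atTop, c * (L : ℝ) ^ (-(3 / 4 : ℝ)) ≤ Literature.Probability.LatticeModels.isingCorr (Literature.Probability.LatticeModels.zdGraph 3) (Literature.Probability.LatticeModels.box 3 L) (Literature.Probability.LatticeModels.criticalBeta 3) 0 .plus {0} := by
  obtain ⟨c, hc, hfreq⟩ :=
    Summit.CriticalPhenomena.Ising3DConformalLimit.Theorems.exists_frequently_mul_rpow_le_criticalTwoPoint_axis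
  refine ⟨Real.sqrt c / 5, by positivity, ?_⟩
  rw [Filter.frequently_atTop]
  intro L₁
  obtain ⟨n, hn, hfloor⟩ := Filter.frequently_atTop.1 hfreq (2 * L₁ + 4)
  set L : ℕ := (n - 2) / 2 with hLdef
  have hL₁ : L₁ ≤ L := by omega
  have hL1 : 1 ≤ L := by omega
  have h2L : 2 * L + 2 ≤ n := by omega
  have hn5L : n ≤ 5 * L := by omega
  refine ⟨L, hL₁, ?_⟩
  have hβ : 0 ≤ criticalBeta 3 := criticalBeta_nonneg 3
  -- `⟨σ₀σ_{ne₁}⟩ ≤ (⟨σ₀⟩⁺_{B(L)})²`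
  have hx : 2 * L + 2 ≤ Site.supNorm (Pi.single 0 (n : ℤ) : Site 3) := by
    rw [Summit.CriticalPhenomena.Ising3DConformalLimit.Theorems.PerfectScreening.supNorm_single_natCast]
    exact h2L
  have hG : criticalTwoPoint 3 (Pi.single 0 (n : ℤ)) ≤
      isingCorr (zdGraph 3) (box 3 L) (criticalBeta 3) 0 .plus {0} ^ 2 :=
    twoPointPlus_le_isingCorr_plus_box_sq (d := 3) hβ hx
  have harm0 : 0 ≤ isingCorr (zdGraph 3) (box 3 L) (criticalBeta 3) 0 .plus {0} :=
    GKSInequalities.gks_one_holds (zdGraph 3) hβ le_rfl (Or.inr rfl)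
      (Finset.singleton_subset_iff.2 (zero_mem_box 3 L))
  have hL0 : (0 : ℝ) < L := by exact_mod_cast hL1
  have hn0 : (0 : ℝ) < n := by exact_mod_cast (by omega : 0 < n)
  -- `(√c/5 · L^{-3/4})² = (c/25) L^{-3/2}`
  have hsq : (Real.sqrt c / 5 * (L : ℝ) ^ (-(3 / 4 : ℝ))) ^ 2 = c / 25 * (L : ℝ) ^ (-(3 / 2 : ℝ)) := by
    have e : ((L : ℝ) ^ (-(3 / 4 : ℝ))) ^ 2 = (L : ℝ) ^ (-(3 / 2 : ℝ)) := by
      rw [← Real.rpow_natCast ((L : ℝ) ^ (-(3 / 4 : ℝ))) 2, ← Real.rpow_mul hL0.le]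
      norm_num
    rw [mul_pow, div_pow, Real.sq_sqrt hc.le, e]
    norm_num
  -- `(c/25) L^{-3/2} ≤ c n^{-3/2}` from `n ≤ 5L` and `5^{3/2} ≤ 25`
  have hcmp : c / 25 * (L : ℝ) ^ (-(3 / 2 : ℝ)) ≤ c * (n : ℝ) ^ (-(3 / 2 : ℝ)) := by
    have hn5L' : (n : ℝ) ≤ 5 * L := by exact_mod_cast hn5L
    have h1 : (5 * (L : ℝ)) ^ (-(3 / 2 : ℝ)) ≤ (n : ℝ) ^ (-(3 / 2 : ℝ)) :=
      Real.rpow_le_rpow_of_nonpos hn0 hn5L' (by norm_num)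
    have h2 : (5 * (L : ℝ)) ^ (-(3 / 2 : ℝ)) = (5 : ℝ) ^ (-(3 / 2 : ℝ)) * (L : ℝ) ^ (-(3 / 2 : ℝ)) :=
      Real.mul_rpow (by norm_num) hL0.le
    have h3 : (1 / 25 : ℝ) ≤ (5 : ℝ) ^ (-(3 / 2 : ℝ)) := by
      rw [Real.rpow_neg (by norm_num), ← one_div]
      apply one_div_le_one_div_of_le (Real.rpow_pos_of_pos (by norm_num) _)
      calc (5 : ℝ) ^ (3 / 2 : ℝ) ≤ (5 : ℝ) ^ ((2 : ℕ) : ℝ) :=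
            Real.rpow_le_rpow_of_exponent_le (by norm_num) (by norm_num)
        _ = 25 := by rw [Real.rpow_natCast]; norm_num
    have hLp : 0 ≤ (L : ℝ) ^ (-(3 / 2 : ℝ)) := Real.rpow_nonneg hL0.le _
    calc c / 25 * (L : ℝ) ^ (-(3 / 2 : ℝ)) = c * ((1 / 25) * (L : ℝ) ^ (-(3 / 2 : ℝ))) := by ring
      _ ≤ c * ((5 : ℝ) ^ (-(3 / 2 : ℝ)) * (L : ℝ) ^ (-(3 / 2 : ℝ))) := by gcongr
      _ = c * (5 * (L : ℝ)) ^ (-(3 / 2 : ℝ)) := by rw [h2]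
      _ ≤ c * (n : ℝ) ^ (-(3 / 2 : ℝ)) := mul_le_mul_of_nonneg_left h1 hc.le
  have hchain : (Real.sqrt c / 5 * (L : ℝ) ^ (-(3 / 4 : ℝ))) ^ 2 ≤
      isingCorr (zdGraph 3) (box 3 L) (criticalBeta 3) 0 .plus {0} ^ 2 := by
    rw [hsq]
    exact hcmp.trans (hfloor.trans hG)
  have hlhs0 : 0 ≤ Real.sqrt c / 5 * (L : ℝ) ^ (-(3 / 4 : ℝ)) := by positivity
  exact (pow_le_pow_iff_left₀ hlhs0 harm0 (by norm_num : (2 : ℕ) ≠ 0)).1 hchain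

/-- **The window of the one-arm certificate.** Any one-arm upper bound `⟨σ₀⟩⁺_{B(L);β_c(3),0} ≤ C L^{-a}` for
all `L ≥ L₀` has `a ≤ 3/4` (`oneArm_frequently_ge_rpow`: `c L^{-3/4} ≤ C L^{-a}` infinitely often forces
`c ≤ C L^{3/4-a} → 0` if `a > 3/4`). With `EtaPositive_of_oneArmGain` (needs `a > 1/2`) the admissible window is
`a ∈ (1/2, 3/4]`. Registered stub of stmt-CriticalPhenomena-2600 (verbatim one-line header). -/
theorem oneArm_exponent_le_threeQuarters : ∀ a C : ℝ, ∀ L₀ : ℕ, (∀ L : ℕ, L₀ ≤ L → Literature.Probability.LatticeModels.isingCorr (Literature.Probability.LatticeModels.zdGraph 3) (Literature.Probability.LatticeModels.box 3 L) (Literature.Probability.LatticeModels.criticalBeta 3) 0 .plus {0} ≤ C * (L : ℝ) ^ (-a)) → a ≤ 3 / 4 := by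
  intro a C L₀ h
  by_contra ha
  push Not at ha
  obtain ⟨c, hc, hfreq⟩ := oneArm_frequently_ge_rpow
  have hlim : Tendsto (fun L : ℕ => C * (L : ℝ) ^ (-(a - 3 / 4))) atTop (𝓝 0) := by
    have h1 : Tendsto (fun t : ℝ => t ^ (-(a - 3 / 4))) atTop (𝓝 0) :=
      tendsto_rpow_neg_atTop (y := a - 3 / 4) (by linarith)
    have h2 : Tendsto (fun L : ℕ => (L : ℝ) ^ (-(a - 3 / 4))) atTop (𝓝 0) :=
      h1.comp tendsto_natCast_atTop_atTop
    simpa only [mul_zero] using h2.const_mul C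
  have hev : ∀ᶠ L : ℕ in atTop, C * (L : ℝ) ^ (-(a - 3 / 4)) < c := hlim.eventually (gt_mem_nhds hc)
  obtain ⟨L, hfloor, hlt, hL⟩ := (hfreq.and_eventually (hev.and (eventually_ge_atTop (max L₀ 1)))).exists
  have hL₀ : L₀ ≤ L := le_of_max_le_left hL
  have hL1 : 1 ≤ L := le_of_max_le_right hL
  have hL0 : (0 : ℝ) < L := by exact_mod_cast hL1
  have hchain : c * (L : ℝ) ^ (-(3 / 4 : ℝ)) ≤ C * (L : ℝ) ^ (-a) := hfloor.trans (h L hL₀)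
  have hp : 0 < (L : ℝ) ^ (3 / 4 : ℝ) := Real.rpow_pos_of_pos hL0 _
  have hmul := mul_le_mul_of_nonneg_right hchain hp.le
  have e1 : c * (L : ℝ) ^ (-(3 / 4 : ℝ)) * (L : ℝ) ^ (3 / 4 : ℝ) = c := by
    rw [mul_assoc, ← Real.rpow_add hL0]; norm_num
  have e2 : C * (L : ℝ) ^ (-a) * (L : ℝ) ^ (3 / 4 : ℝ) = C * (L : ℝ) ^ (-(a - 3 / 4)) := by
    rw [mul_assoc, ← Real.rpow_add hL0]
    congr 2; ring
  rw [e1, e2] at hmul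
  linarith

end Summit.CriticalPhenomena.Ising3DConformalLimit.AnomalousForcesInteractionEtaPositive
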